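import Summits.Ventures.YMGap.SlabAreaLawSU3
import Literature.MathematicalPhysics.QuantumFieldTheory.DurhuusFrohlichSlabCriterionProofs
import HarnessLib

/-!
# Venture YMGap, track (a) / A4 — the `SU(3)` slab door at LARGER RADIUS (`d = 4`, Wilson units `β_W = 6/g²`)

HONEST FRAMING: venture file of the cell `pub-ymgap` (QuantumFields programme), seat engine-2 (g3).  Kernel ARITHMETIC over the
tree theorem `Slab.su3_hasAreaLaw_of_poincare_of_varianceBound` (`SlabAreaLawSU3`): the slab Dobrushin door fed with pub-balaban's
Poincaré–variance one-link modulus `OneLinkKRModulus 3 R √(cv)` gives Wilson's AREA LAW `HasAreaLaw 4 (fundamentalRep (Fin 3)) (β_W/3)`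
whenever `2β_W/3 ≤ R` and `(2β_W/3)²·(c·v) < 1`, modulo the Durhuus–Fröhlich/Cao–Nissim–Sheffield criterion — which is now a tree
THEOREM (`durhuusFrohlich_areaLaw_of_slabClustering_holds`, `DurhuusFrohlichSlabCriterionProofs`), so every row below is conditional ONLY on
the two displayed one-link hypothesis schemas (finite-dimensional inequalities about ONE tilted Haar law on `SU(3)`; `@[conjecture] def`s of
pub-balaban leaves (38)/(40), NOTHING asserted about them here).

WHY A NEW RADIUS.  The cell's `SU(3)` row `β_W ≤ 11/20` (`su3_hasAreaLaw_le_elevenTwentieths`, resp. `SlabAreaLawVariance`) stops at `11/20`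
because `11/30 = 2·(11/20)/3` is the largest radius at which one-link constants had been certified (pub-balaban g17), NOT because the door
closes: the slab door product there is `(11/30)²·(53/100)(49/20) = 0.1746…` (`su3_slabDoor_numbers`).  The slab door constant `2β_W/3` is one
third of the DLR door's, so the area-law row is limited by the RADIUS of the certificates.  This file displays the door at two larger radii:
* `su3_hasAreaLaw_of_poincare_of_varianceBound_radius` — the generic DF-free form: `OneLinkPoincareSUN 3 R c`, `OneLinkVarianceBound 3 R v`, `R²·(cv) < 1`
  ⇒ area law for every `0 ≤ β_W ≤ 3R/2`;
* `su3_hasAreaLaw_le_nineTenths_of_poincare_of_varianceBound` — **IF** `OneLinkPoincareSUN 3 (3/5) (4/5)` (spectral gap `≥ 5/4` of the tilted one-link law on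
  `‖B‖_op ≤ 3/5`) **AND** `OneLinkVarianceBound 3 (3/5) (17/5)` **THEN** AREA LAW for `SU(3)`, `d = 4`, for ALL `0 ≤ β_W ≤ 9/10` (door product
  `(3/5)²·(4/5)(17/5) = 612/625 < 1`).  Printed comparison: CNS25 Thm. 1.6 gives `β_W < 3/8`; the cell row is `11/20`;
* `su3_hasAreaLaw_le_one_of_poincare_of_varianceBound` — the same at radius `2/3` with the pair `(7/10, 16/5)` (door `224/225`): area law for ALL `0 ≤ β_W ≤ 1`.
STATUS OF THE HYPOTHESES AT FILING: DISPLAYED, NOT certified, NOT proved.  Numerical reconnaissance (engine-2 g3, floats, NOT evidence): on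
`‖B‖_op ≤ R` the gap is minimal and the variance maximal at `B = −R·𝟙`, with gap `1.8001` / variance `2.7688` at `R = 3/5` (margins `31 %` /
`23 %` to `5/4` / `17/5`) and `1.7322` / `2.8987` at `R = 2/3` (margins `17.5 %` / `10.4 %` to `10/7` / `16/5`); certification = two-engine
ball-arithmetic runs of pub-balaban's σ2 (Peter–Weyl + Schur inertia) and σ1-iv (character expansion + nuclear Grönwall) engines at these
radii, booked by the cell lead.  CLASS when certified: K × C (kernel theorem × two certified finite-dimensional inequalities).
Strong-coupling LATTICE statements only; no continuum limit, no mass-gap or Clay claim, nothing about `d ≠ 4`.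
-/

noncomputable section

open Literature.MathematicalPhysics.QuantumLattice (fundamentalRep)
open Literature.MathematicalPhysics.QuantumFieldTheory
open Summit.QuantumFields.BalabanUV.InfraRed.StrongCouplingVarianceDoorSUN (OneLinkVarianceBound)
open Summit.QuantumFields.BalabanUV.InfraRed.StrongCouplingPoincareDoorSUN (OneLinkPoincareSUN)

namespace Summit.Ventures.YMGap.Slab

/-- **`SU(3)`, `d = 4`, Wilson units — the slab door at radius `R`, Durhuus–Fröhlich door DISCHARGED**: the two one-link hypothesis schemas
`OneLinkPoincareSUN 3 R c` and `OneLinkVarianceBound 3 R v` (DISPLAYED, nothing asserted) with `0 ≤ c, v` and the slab door `R²·(c·v) < 1` give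
Wilson's AREA LAW `HasAreaLaw 4 (fundamentalRep (Fin 3)) (β_W/3)` for every `0 ≤ β_W ≤ 3R/2` (i.e. `2β_W/3 ≤ R`).  This is
`su3_hasAreaLaw_of_poincare_of_varianceBound` with the criterion hypothesis supplied by the tree theorem
`durhuusFrohlich_areaLaw_of_slabClustering_holds` and the door monotone in `β_W`. [cite: CaoNissimSheffield2025dynamical, Theorem 2.3]
[cite: Follmer1988, Ch. I Theorem (2.13)] -/
theorem su3_hasAreaLaw_of_poincare_of_varianceBound_radius {R c v : ℝ} (hc : 0 ≤ c) (hv0 : 0 ≤ v) (hP : OneLinkPoincareSUN 3 R c)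
    (hv : OneLinkVarianceBound 3 R v) (hdoor : R ^ 2 * (c * v) < 1) {βW : ℝ} (hβ : 0 ≤ βW) (hle : 2 * βW / 3 ≤ R) :
    HasAreaLaw 4 (fundamentalRep (Fin 3)) (βW / 3) := by
  refine su3_hasAreaLaw_of_poincare_of_varianceBound durhuusFrohlich_areaLaw_of_slabClustering_holds hβ hc hv0 hle hP hv ?_
  have h0 : 0 ≤ 2 * βW / 3 := by positivity
  have hsq : (2 * βW / 3) ^ 2 ≤ R ^ 2 := pow_le_pow_left₀ h0 hle 2
  exact lt_of_le_of_lt (mul_le_mul_of_nonneg_right hsq (mul_nonneg hc hv0)) hdoor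

/-- **`SU(3)` AREA LAW FOR ALL `0 ≤ β_W ≤ 9/10`, `d = 4` — CONDITIONAL on the radius-`3/5` pair** (engine-2 g3, the cell's next `SU(3)` rung):
IF `OneLinkPoincareSUN 3 (3/5) (4/5)` (every Frobenius-`M`-Lipschitz observable has variance `≤ (4/5)M²` under the tilted one-link law
`ν_B ∝ exp(3 Re tr(gB)) Haar` for all `‖B‖_op ≤ 3/5`; equivalently spectral gap `≥ 5/4`; NOT proved, displayed) AND
`OneLinkVarianceBound 3 (3/5) (17/5)` (`Var_{ν_B}(3 Re tr(gΔ)) ≤ (17/5)‖Δ‖_F²` on the same ball; NOT proved, displayed) THEN Wilson's AREA LAW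
`HasAreaLaw 4 (fundamentalRep (Fin 3)) (β_W/3)` holds for every `0 ≤ β_W ≤ 9/10` — against the printed CNS25 Thm. 1.6 threshold `3/8` and the
cell row `11/20`.  Door product `(3/5)²·(4/5)(17/5) = 612/625 < 1` (`su3_slabRadius_numbers`).  Class: K-conditional on the two displayed
finite-dimensional hypotheses; strong-coupling lattice statement only. [cite: CaoNissimSheffield2025dynamical, Theorems 1.6 and 2.3] -/
theorem su3_hasAreaLaw_le_nineTenths_of_poincare_of_varianceBound (hP : OneLinkPoincareSUN 3 (3 / 5) (4 / 5))
    (hv : OneLinkVarianceBound 3 (3 / 5) (17 / 5)) {βW : ℝ} (hβ : 0 ≤ βW) (hle : βW ≤ 9 / 10) :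
    HasAreaLaw 4 (fundamentalRep (Fin 3)) (βW / 3) :=
  su3_hasAreaLaw_of_poincare_of_varianceBound_radius (by norm_num) (by norm_num) hP hv (by norm_num) hβ (by linarith)

/-- `SU(3)`, `d = 4`, the endpoint `β_W = 9/10` (tree coupling `3/10`), conditional on the radius-`3/5` pair. [folklore] -/
theorem su3_hasAreaLaw_nineTenths_of_poincare_of_varianceBound (hP : OneLinkPoincareSUN 3 (3 / 5) (4 / 5))
    (hv : OneLinkVarianceBound 3 (3 / 5) (17 / 5)) : HasAreaLaw 4 (fundamentalRep (Fin 3)) ((9 / 10 : ℝ) / 3) :=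
  su3_hasAreaLaw_le_nineTenths_of_poincare_of_varianceBound hP hv (by norm_num) le_rfl

/-- **`SU(3)` AREA LAW FOR ALL `0 ≤ β_W ≤ 1`, `d = 4` — CONDITIONAL on the radius-`2/3` pair** (displayed for the ladder; priced, not yet
booked): IF `OneLinkPoincareSUN 3 (2/3) (7/10)` (spectral gap `≥ 10/7` on `‖B‖_op ≤ 2/3`; NOT proved) AND `OneLinkVarianceBound 3 (2/3) (16/5)`
(NOT proved) THEN `HasAreaLaw 4 (fundamentalRep (Fin 3)) (β_W/3)` for every `0 ≤ β_W ≤ 1`.  Door product `(2/3)²·(7/10)(16/5) = 224/225 < 1`.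
[cite: CaoNissimSheffield2025dynamical, Theorem 2.3] -/
theorem su3_hasAreaLaw_le_one_of_poincare_of_varianceBound (hP : OneLinkPoincareSUN 3 (2 / 3) (7 / 10))
    (hv : OneLinkVarianceBound 3 (2 / 3) (16 / 5)) {βW : ℝ} (hβ : 0 ≤ βW) (hle : βW ≤ 1) :
    HasAreaLaw 4 (fundamentalRep (Fin 3)) (βW / 3) :=
  su3_hasAreaLaw_of_poincare_of_varianceBound_radius (by norm_num) (by norm_num) hP hv (by norm_num) hβ (by linarith)

/-- The radius-`3/5` pair also re-derives the cell's `11/20` row (monotonicity of both schemas in the radius): a CONSISTENCY statement —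
once the `9/10` hypotheses are certified the `11/20` row needs no separate certificate. [folklore] -/
theorem su3_hasAreaLaw_le_elevenTwentieths_of_nineTenths_pair (hP : OneLinkPoincareSUN 3 (3 / 5) (4 / 5))
    (hv : OneLinkVarianceBound 3 (3 / 5) (17 / 5)) {βW : ℝ} (hβ : 0 ≤ βW) (hle : βW ≤ 11 / 20) :
    HasAreaLaw 4 (fundamentalRep (Fin 3)) (βW / 3) :=
  su3_hasAreaLaw_le_nineTenths_of_poincare_of_varianceBound hP hv hβ (by linarith)

/-- Numbers of this leaf (all by `norm_num`): the two door products `612/625` (radius `3/5`) and `224/225` (radius `2/3`), both `< 1`; the radii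
are `2β_W/3` at `β_W = 9/10` and `β_W = 1`; the ladder `3/8 < 11/20 < 9/10 < 1`; the Haar floors `c ≥ 3/8`, `v ≥ 3/2` of the two schemas lie
below the displayed constants; and — orientation only, NO theorem uses it — the DLR door of pub-balaban leaf (41) with the radius-`3/5` pair is
SHUT at `β_W = 9/10` (`(18·(9/10)/9)²·(4/5)(17/5) = 8.81… ≥ 1`): these constants serve the AREA-LAW door only. [folklore] -/
theorem su3_slabRadius_numbers :
    (3 / 5 : ℝ) ^ 2 * (4 / 5 * (17 / 5)) = 612 / 625 ∧ (612 / 625 : ℝ) < 1 ∧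
      (2 / 3 : ℝ) ^ 2 * (7 / 10 * (16 / 5)) = 224 / 225 ∧ (224 / 225 : ℝ) < 1 ∧
      (2 : ℝ) * (9 / 10) / 3 = 3 / 5 ∧ (2 : ℝ) * 1 / 3 = 2 / 3 ∧
      (3 : ℝ) / 8 < 11 / 20 ∧ (11 : ℝ) / 20 < 9 / 10 ∧ (9 : ℝ) / 10 < 1 ∧
      (3 : ℝ) / 8 < 4 / 5 ∧ (3 : ℝ) / 8 < 7 / 10 ∧ (3 : ℝ) / 2 < 17 / 5 ∧ (3 : ℝ) / 2 < 16 / 5 ∧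
      ¬ (18 * ((9 / 10 : ℝ) / 9)) ^ 2 * (4 / 5 * (17 / 5)) < 1 := by
  norm_num

end Summit.Ventures.YMGap.Slab
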